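import Summits.NavierStokesRegularity.NavierStokesRegularity.Theses.PalasekTowerBreakdown
import Summits.NavierStokesRegularity.FluidComputer.PalasekTowerGermHostNumericDesign

/-!
# `EpisodeBase` BY NAME for amplifiers given as a VECTOR POTENTIAL, and one hypothesis-free numeric host

Cell `ns-blowup`, seat `ns-blowup-ecbridge-3` (g5); GROUP C «BRIDGE SUPPORT» of the route
`PalasekTowerBreakdown`, crux `EpisodeBase` (item stmt-NavierStokesRegularity-19179, R2 of record; line `slot` v5,
stub `stub_explicit_slice_run`). Sequel of `PalasekTowerBreakdownEpisodeBaseNumericAmplifier.lean` over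
`FluidComputer/PalasekTowerGermHostPotentialAmplifier.lean` (XXVIII: `W = curl A`) and
`FluidComputer/PalasekTowerGermHostNumericDesign.lean` (XXIX: the demonstration design). LABEL: E–C typing (KERNEL,
proofs only, by name). WHAT THIS IS NOT: not Navier–Stokes evidence — the prescribed level-`0` host of PRESCRIBED
composite profiles and conditionals whose hypothesis is the OPEN episode of those designs (for the demonstration
design, an episode nobody expects); nothing about any flow after `τ₀`, `RungG 1` or blow-up. HELPER for 19179
(`--supports`), closes nothing.

* `palasekTowerBreakdown_episodeBase_of_curl_firstEpisodeD` / `…_levelWitness`: for `0 < a ≤ 11/648`,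
  `A ∈ C_c^∞` with `tsupport A ⊆ B̄(0, R)`, `‖DA‖ ≤ L`, `4L < Y₀`, `1/N₀ ≤ d`, `7 + d + R < ‖c‖` and the closed-form
  budget `(3/(2πd⁴)) Y₀ (4L)² (4π/3) R³ < Y₀³/200000`: `EpisodeBase ⇐` the episode (resp. one level witness) of the
  germ schedule of `strictTinyProfile a + curl A (· − c)`;
* `palasekTowerBreakdown_exists_preparedHost_demo`: with NO hypothesis, a pinned, rigid, quiet schedule of radius
  `125/4`, `τ₀ = 1`, push `c₄ = 1`, PREPARED in its singleton class, whose episode gives the crux — the germ schedule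
  of `strictTinyProfile (1/64) + curl demoPot (· − 30e₁)`.

References: S. Palasek, arXiv:2605.13827 §3.3, §4 (Step 2) [cite: Palasek2026ElementaryModel, §4];
H. Sohr, *The Navier–Stokes Equations* (2001), Ch. V Thm. 1.5.1 [cite: Sohr2001, Ch. V Thm. 1.5.1].
-/

noncomputable section

-- `Summit.<Summit>.<Problem>` is the tree's mandated summit-side namespace (CONVENTIONS §2); for this
-- single-conjunct summit the two coincide, so the duplicate is deliberate.
set_option linter.dupNamespace false

namespace Summit.NavierStokesRegularity.NavierStokesRegularity.Theorems

open Set Function Metric MeasureTheory Real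
open scoped ContDiff RealInnerProductSpace
open Summit.NavierStokesRegularity.FluidComputer.PalasekTowerClayBridge
open Summit.NavierStokesRegularity.FluidComputer.PalasekTowerClayBridge.Germ
open Literature.Analysis.FluidPDE

section Curl

variable {a : ℝ} (ha : 0 < a) (h : a ≤ 11 / 648)
  {A : EuclideanSpace ℝ (Fin 3) → EuclideanSpace ℝ (Fin 3)} {R L d : ℝ} {c : EuclideanSpace ℝ (Fin 3)}
  (hA : ContDiff ℝ ∞ A) (hAsupp : tsupport A ⊆ closedBall 0 R) (hR : 0 ≤ R)
  (hL : ∀ x, ‖fderiv ℝ A x‖ ≤ L) (hLY : 4 * L < TowerRates.wide.Y 0) (hdN : 1 / TowerRates.wide.N 0 ≤ d)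
  (hc : 7 + d + R < ‖c‖)
  (hbudget : 3 / (2 * π * d ^ 4) * TowerRates.wide.Y 0 * ((4 * L) ^ 2 * (R ^ 3 * (π * 4 / 3))) <
    TowerRates.wide.Y 0 ^ 3 / 200000)

include ha h hA hAsupp hR hL hLY hdN hc hbudget

/-- **`EpisodeBase` from the EPISODE of «numeric carrier + `curl A` far away»** (closed-form budget).
[cite: Palasek2026ElementaryModel, §4] -/
theorem palasekTowerBreakdown_episodeBase_of_curl_firstEpisodeD {c₄ : ℝ} (hc₄ : 0 < c₄) (hc₄' : c₄ ≤ 1)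
    (hF : FirstEpisodeD (HostClass.exact
      ((levelZeroData_strictTinyProfile_add_curl_of_le ha h hA hAsupp hR hL hLY hdN hc hbudget).schedule
        c₄ hc₄ hc₄'))) :
    Summit.NavierStokesRegularity.NavierStokesRegularity.Theses.PalasekTowerBreakdown.EpisodeBase :=
  (levelZeroData_strictTinyProfile_add_curl_of_le ha h hA hAsupp hR hL hLY hdN hc hbudget).episodeBaseG_of_firstEpisodeD
    hc₄ hc₄' hF

/-- **`EpisodeBase` from ONE LEVEL WITNESS of «numeric carrier + `curl A` far away»** (no re-push).
[cite: Sohr2001, Ch. V Thm. 1.5.1] -/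
theorem palasekTowerBreakdown_episodeBase_of_curl_levelWitness {c₄ : ℝ} (hc₄ : 0 < c₄) (hc₄' : c₄ ≤ 1)
    (hLW : ((levelZeroData_strictTinyProfile_add_curl_of_le ha h hA hAsupp hR hL hLY hdN hc hbudget).schedule
      c₄ hc₄ hc₄').LevelWitness 1 0) :
    Summit.NavierStokesRegularity.NavierStokesRegularity.Theses.PalasekTowerBreakdown.EpisodeBase := by
  have hLZ := levelZeroData_strictTinyProfile_add_curl_of_le ha h hA hAsupp hR hL hLY hdN hc hbudget
  exact hLZ.episodeBaseG_of_firstEpisodeD hc₄ hc₄'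
    (firstEpisodeD_exact_of_levelWitness_self (hLZ.schedule_pins hc₄ hc₄') (hLZ.schedule_rigid hc₄ hc₄')
      (hLZ.schedule_quiet hc₄ hc₄') hLW)

end Curl

/-- **A HYPOTHESIS-FREE PREPARED HOST OF A COMPOSITE NUMERIC DESIGN** (∃-packaged): a pinned (`Λ = 8`, `θ = 6/5`),
rigid, quiet schedule on the wide rates of radius `125/4`, readout time `τ₀ = 1` and push `c₄ = 1`, PREPARED in its
singleton class, whose episode gives the crux — the germ schedule of `strictTinyProfile (1/64) + curl demoPot (· − 30e₁)`
(`Germ.levelZeroData_demo`). [cite: Palasek2026ElementaryModel, §4] -/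
theorem palasekTowerBreakdown_exists_preparedHost_demo :
    ∃ S : Schedule TowerRates.wide, S.Pins 8 (6 / 5) ∧ S.Rigid ∧ S.Quiet ∧ S.radius = 125 / 4 ∧ S.τ 0 = 1 ∧
      HostPreparationD (HostClass.exact S) ∧
        (FirstEpisodeD (HostClass.exact S) →
          Summit.NavierStokesRegularity.NavierStokesRegularity.Theses.PalasekTowerBreakdown.EpisodeBase) :=
  ⟨levelZeroData_demo.schedule 1 one_pos le_rfl, levelZeroData_demo.schedule_pins one_pos le_rfl,
    levelZeroData_demo.schedule_rigid one_pos le_rfl, levelZeroData_demo.schedule_quiet one_pos le_rfl,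
    levelZeroData_demo.schedule_radius one_pos le_rfl, levelZeroData_demo.schedule_τ_zero one_pos le_rfl,
    levelZeroData_demo.hostPreparationD_exact one_pos le_rfl,
    fun hF => levelZeroData_demo.episodeBaseG_of_firstEpisodeD one_pos le_rfl hF⟩

end Summit.NavierStokesRegularity.NavierStokesRegularity.Theorems

end
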